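import Summits.BirchSwinnertonDyer.BirchSwinnertonDyer.Theses.AdditiveKolyvaginRoad
import Summits.BirchSwinnertonDyer.BirchSwinnertonDyer.Theorems.AdditiveKolyvaginRoadLevelKolyvaginSystemsAdditiveRankOneVanishingEngine
import Summits.BirchSwinnertonDyer.BirchSwinnertonDyer.Theorems.AdditiveKolyvaginRoadInductionOfLevelSystemsLocalGlobal
import Summits.BirchSwinnertonDyer.BirchSwinnertonDyer.Theorems.AdditiveKolyvaginRoadKolyvaginSupplyOfPoitouTate
import HarnessLib

/-!
# Route `AdditiveKolyvaginRoad`, crux KS′ `LevelKolyvaginSystemsAdditive` (item stmt-BirchSwinnertonDyer-21396):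
# VANISHING ORDER ZERO AT TOTAL RANK ONE — the registered stub `stub_kolyvaginRankOneVanishing` of line
# `additive_fibre_ignition`, PROVED (cell `pub/bsd-wall`, width seat `bsd-wall-akr-p2x-w2` g3;
# `--supports stmt-BirchSwinnertonDyer-21396`, helper; part 2 of 2)

WHY THIS FILE. See part 1 (`…RankOneVanishingEngine.lean`): the last step of the m-direction twin of line
`additive_fibre_ignition` — at a non-empty even level `n₀` of total canonical rank `≤ 1`, some `κ₀ m n₀ ≠ 0` forces
`κ₀ ∅ n₀ ≠ 0` — is W. Zhang's Lemma 8.4 (1) (`dim Sel^{ε_ν} = ν + 1` at the vanishing order `ν`, so `ν = 0`), which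
part 1 delivers in dictionary currency (`kappa_empty_ne_zero_of_dictionaries`).

WHAT.
* §3 `kappa_empty_ne_zero_of_localPackage` — the same from a `KolyvaginLocalPackageP` over the genuine localisations
  `loc_v = galoisCohomology.localization (E[p]) v 1` (as `ZMod p`-linear maps), the places `(ℓ)` of the inert
  Kolyvagin primes, the eigenspaces and the level-`n₀` structure (Kummer at infinity and above no level prime, TORIC
  above the level primes): (REC), (Iso), (Perf), (Line), (Supply) read off the package, (Cheb) ×2 from McCallum's
  Cor. 3.2 (`chebOne_of_mcCallum_P`, `chebTwo_of_mcCallum_P`), the per-place dictionaries of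
  `AdditiveKolyvaginRoadLocalDictionaries` — akr-p1's local–global layer re-run at one level;
* §4 `kolyvaginRankOneVanishing` — the REGISTERED SIGNATURE of `stub_kolyvaginRankOneVanishing` verbatim
  (PUB → DUAL → ♯ frame → abstract bipartite datum → at a non-empty even level `n₀` of total rank `≤ 1`,
  `(∃ m, κ₀ m n₀ ≠ 0) → κ₀ ∅ n₀ ≠ 0`): the package from DUAL.2 (`kolyvaginLocalPackageP_of_poitouTate`), then §3
  with the datum's rows at `n₀`. Of the frame it uses only `5 ≤ p`, `ρ̄` onto, `K` imaginary quadratic, `d_K < −4`,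
  `c ≠ 1`; of the datum only the sign row and the five local rows at `n₀` (realisation, the laws (A)/(B) and `lam`
  are idle here, as they should be: Lemma 8.4 is a statement about ONE level).

HONEST FRAMING: two theorems; 0 definitions, 0 named facts, 0 `sorry`; CONDITIONAL on nothing beyond the displayed
DUAL conjunct it is handed (PUB is not even opened). Closes nothing by itself: it discharges ONE registered stub of ONE
line of crux KS′; the line's open stubs (K1 = the geometric bipartite datum at `p² ∣ N`, the ignition, the climb) are
untouched, KS′ is not proved here, and BSD is NOT proved by any of this.

References: [cite: WZhang2014, §8.1, Lemma 8.1, Lemma 8.2, Lemma 8.4 (1), pp. 234–239]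
[cite: McCallumLMS1991, Prop. 3.1, Cor. 3.2, Lemma 5.3] [cite: MilneADT2006, Ch. I, Thm. 4.10]
[cite: GrossLMS1991, Prop. 5.4 (2)].
-/

-- single-conjunct summit: `Summit.BirchSwinnertonDyer.BirchSwinnertonDyer.…` repeats the name by design
set_option linter.dupNamespace false
set_option autoImplicit false

noncomputable section

open scoped Classical

namespace Summit.BirchSwinnertonDyer.BirchSwinnertonDyer.Theorems.AdditiveKoly

open WeierstrassCurve NumberField IsDedekindDomain
  Literature.NumberTheory.EllipticCurves Literature.NumberTheory.EllipticCurves.ModularForms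
  Literature.NumberTheory.EllipticCurves.Rank1Residual Literature.NumberTheory.GaloisRepresentations Module
  Summit.BirchSwinnertonDyer.Rank1Residual.X11b.Three.Koly
  Summit.BirchSwinnertonDyer.Rank1Residual.X11b.Three.Koly.Method2
  Summit.BirchSwinnertonDyer.BirchSwinnertonDyer.Theses.AdditiveKolyvaginRoad

section Package

variable (W : WeierstrassCurve ℚ) (K : Type) [Field K] [NumberField K] (p : ℕ)
variable [W.IsElliptic] [W.IsGloballyMinimal] [NeZero (W.conductorNorm ℤ)] [Fact p.Prime]
  (ι : K →+* ℂ) (c : K ≃ₐ[ℚ] K) [Module (ZMod p) (Vp W K p)]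

/-! ## §3 From the local–global package -/

variable [∀ v : Place K, Module (ZMod p)
    (galoisCohomology (((W.baseChange K).torsionGaloisModule ((p ^ 1 : ℕ) : ℤ)).toLocal v) 1)]

/-- **Vanishing order zero at total rank `≤ 1`, from the LOCAL–GLOBAL PACKAGE.** At a frame (`K` imaginary
quadratic, `p` odd, `ρ̄_{E,p}` onto, `c ≠ 1`) with a `KolyvaginLocalPackageP Lp`: classes `κ m` at a NON-EMPTY level
`n₀` with their rows in the tree's currency (sign `ε ^^ bodd #m`, Selmer off `m ∪ n₀` and at infinity, toric above
`n₀`, transverse above `m`, relation (8.1)), total rank `≤ 1`, some `κ m ≠ 0` ⟹ `κ ∅ ≠ 0`. Proof: §2 over the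
genuine localisations and the places `(ℓ)`, with (REC) (Iso) (Perf) (Line) (Supply) read off `Lp` and (Cheb) ×2 from
McCallum's Cor. 3.2 — akr-p1's local–global layer re-run at one level. [cite: WZhang2014, Lemma 8.4 (1), Lemma 8.2,
§8.1] [cite: MilneADT2006, Ch. I, Thm. 4.10] [cite: McCallumLMS1991, Cor. 3.2] -/
theorem kappa_empty_ne_zero_of_localPackage (hp2 : p ≠ 2) (hK : IsImaginaryQuadratic K)
    (hsurj : W.HasSurjectiveModNGaloisRep p) (hc : c ≠ 1) (Lp : KolyvaginLocalPackageP W K p ι c)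
    (n₀ : Finset (AdmQ W K p)) (hn₀ : n₀.Nonempty) (ε : Bool)
    (κ : Finset {ℓ // Zhang2014.IsKolyvaginPrime (W.conductorNorm ℤ) W K p ℓ} → Vp W K p)
    (hsign : ∀ m : Finset {ℓ // Zhang2014.IsKolyvaginPrime (W.conductorNorm ℤ) W K p ℓ},
      conjAct W c ((p ^ 1 : ℕ) : ℤ) (κ m) = sgnP (ε ^^ Nat.bodd m.card) • κ m)
    (hoff : ∀ (m : Finset {ℓ // Zhang2014.IsKolyvaginPrime (W.conductorNorm ℤ) W K p ℓ}) (v : HeightOneSpectrum (𝓞 K)),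
      (∀ ℓ ∈ m, ((ℓ : ℕ) : 𝓞 K) ∉ v.asIdeal) → (∀ q ∈ n₀, ((q : ℕ) : 𝓞 K) ∉ v.asIdeal) →
      κ m ∈ selmerLocalKer (W.baseChange K) (v.adicCompletion K) ((p ^ 1 : ℕ) : ℤ))
    (hinf : ∀ (m : Finset {ℓ // Zhang2014.IsKolyvaginPrime (W.conductorNorm ℤ) W K p ℓ}) (w : InfinitePlace K),
      κ m ∈ selmerLocalKer (W.baseChange K) w.Completion ((p ^ 1 : ℕ) : ℤ))
    (htor : ∀ m : Finset {ℓ // Zhang2014.IsKolyvaginPrime (W.conductorNorm ℤ) W K p ℓ}, ∀ q ∈ n₀,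
      ∀ v : HeightOneSpectrum (𝓞 K), ((q : ℕ) : 𝓞 K) ∈ v.asIdeal →
      κ m ∈ toricLocalKer (W.baseChange K) (v.adicCompletion K) ((p ^ 1 : ℕ) : ℤ))
    (htr : ∀ m : Finset {ℓ // Zhang2014.IsKolyvaginPrime (W.conductorNorm ℤ) W K p ℓ}, ∀ ℓ ∈ m,
      ∀ v : HeightOneSpectrum (𝓞 K), ((ℓ : ℕ) : 𝓞 K) ∈ v.asIdeal → κ m ∈ transverseLocalKerP W K p ι ℓ v)
    (hrel : ∀ (m : Finset {ℓ // Zhang2014.IsKolyvaginPrime (W.conductorNorm ℤ) W K p ℓ})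
      (ℓ : {ℓ // Zhang2014.IsKolyvaginPrime (W.conductorNorm ℤ) W K p ℓ}), ℓ ∉ m →
      ∀ v : HeightOneSpectrum (𝓞 K), ((ℓ : ℕ) : 𝓞 K) ∈ v.asIdeal →
      (κ (insert ℓ m) ∈ (W.baseChange K).torsionLocalKer (v.adicCompletion K) ((p ^ 1 : ℕ) : ℤ) ↔
        κ m ∈ (W.baseChange K).torsionLocalKer (v.adicCompletion K) ((p ^ 1 : ℕ) : ℤ)))
    (hrk : finrank (ZMod p) (SelQP W K p c n₀ true) + finrank (ZMod p) (SelQP W K p c n₀ false) ≤ 1)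
    (hne : ∃ m, κ m ≠ 0) : κ ∅ ≠ 0 := by
  -- the concrete apparatus: genuine localisations (as `ZMod p`-linear maps), places, eigenspaces, local conditions
  let ρ := (W.baseChange K).torsionGaloisModule ((p ^ 1 : ℕ) : ℤ)
  let loc : (v : Place K) → Vp W K p →ₗ[ZMod p] galoisCohomology (ρ.toLocal v) 1 := fun v ↦
    (show Vp W K p →+ galoisCohomology (ρ.toLocal v) 1 from galoisCohomology.localization ρ v 1).toZModLinearMap p
  let plK : {ℓ // Zhang2014.IsKolyvaginPrime (W.conductorNorm ℤ) W K p ℓ} → HeightOneSpectrum (𝓞 K) := fun ℓ ↦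
    ⟨Ideal.span {((ℓ : ℕ) : 𝓞 K)}, ℓ.2.2.2.2.2.1, by
      rw [Ne, Ideal.span_singleton_eq_bot]; exact_mod_cast ℓ.2.1.ne_zero⟩
  have hplK : ∀ ℓ, ((ℓ : ℕ) : 𝓞 K) ∈ (plK ℓ).asIdeal := fun ℓ ↦ Ideal.mem_span_singleton_self _
  -- uniqueness of the place above an inert Kolyvagin prime
  have hKuniq : ∀ (ℓ : {ℓ // Zhang2014.IsKolyvaginPrime (W.conductorNorm ℤ) W K p ℓ}) (v : HeightOneSpectrum (𝓞 K)),
      ((ℓ : ℕ) : 𝓞 K) ∈ v.asIdeal → v = plK ℓ := by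
    intro ℓ v hv
    have hle : Ideal.span {((ℓ : ℕ) : 𝓞 K)} ≤ v.asIdeal := by
      rw [Ideal.span_le, Set.singleton_subset_iff]; exact hv
    have hmax := (plK ℓ).isPrime.isMaximal (plK ℓ).ne_bot
    exact HeightOneSpectrum.ext ((hmax.eq_of_le v.isPrime.ne_top hle).symm)
  let E : Bool → Submodule (ZMod p) (Vp W K p) := fun s ↦
    AddSubgroup.toZModSubmodule p (conjAct W c ((p ^ 1 : ℕ) : ℤ) - sgnP s • AddMonoidHom.id (Vp W K p)).ker
  have hE : ∀ (s : Bool) (x : Vp W K p), x ∈ E s ↔ conjAct W c ((p ^ 1 : ℕ) : ℤ) x = sgnP s • x :=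
    fun s x ↦ mem_eigenSubmoduleP_iff W K p c s x
  let Kum : (v : Place K) → Submodule (ZMod p) (galoisCohomology (ρ.toLocal v) 1) := fun v ↦
    AddSubgroup.toZModSubmodule p ((W.baseChange K).kummerLocalConditionAt ((p ^ 1 : ℕ) : ℤ) (Place.Completion v))
  let Tor : (v : HeightOneSpectrum (𝓞 K)) → Submodule (ZMod p) (galoisCohomology (ρ.toLocal (Sum.inr v)) 1) :=
    fun v ↦ Submodule.map (loc (Sum.inr v))
      (AddSubgroup.toZModSubmodule p (toricLocalKer (W.baseChange K) (v.adicCompletion K) ((p ^ 1 : ℕ) : ℤ)))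
  let Tr : (ℓ : {ℓ // Zhang2014.IsKolyvaginPrime (W.conductorNorm ℤ) W K p ℓ}) →
      Submodule (ZMod p) (galoisCohomology (ρ.toLocal (Sum.inr (plK ℓ))) 1) := fun ℓ ↦
    Submodule.map (loc (Sum.inr (plK ℓ))) (AddSubgroup.toZModSubmodule p (transverseLocalKerP W K p ι ℓ (plK ℓ)))
  let L : (v : Place K) → Submodule (ZMod p) (galoisCohomology (ρ.toLocal v) 1) := fun v ↦ match v with
      | Sum.inl w => Kum (Sum.inl w)
      | Sum.inr v' => if ∃ q ∈ n₀, ((q : ℕ) : 𝓞 K) ∈ v'.asIdeal then Tor v' else Kum (Sum.inr v')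
  -- per-place dictionaries for the genuine localisations
  have hZero : ∀ (v : HeightOneSpectrum (𝓞 K)) (x : Vp W K p),
      x ∈ (W.baseChange K).torsionLocalKer (v.adicCompletion K) ((p ^ 1 : ℕ) : ℤ) ↔ loc (Sum.inr v) x = 0 :=
    fun v x ↦ mem_torsionLocalKer_iff_localization_eq_zero_P W K p v x
  have hKumFin : ∀ (v : HeightOneSpectrum (𝓞 K)) (x : Vp W K p),
      x ∈ selmerLocalKer (W.baseChange K) (v.adicCompletion K) ((p ^ 1 : ℕ) : ℤ) ↔
        loc (Sum.inr v) x ∈ Kum (Sum.inr v) := by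
    intro v x
    rw [AddSubgroup.mem_toZModSubmodule]
    exact mem_selmerLocalKer_iff_localization_mem_kummer_P W K p v x
  have hKumInf : ∀ (w : InfinitePlace K) (x : Vp W K p),
      x ∈ selmerLocalKer (W.baseChange K) w.Completion ((p ^ 1 : ℕ) : ℤ) ↔ loc (Sum.inl w) x ∈ Kum (Sum.inl w) := by
    intro w x
    rw [AddSubgroup.mem_toZModSubmodule]
    exact mem_selmerLocalKer_iff_localization_mem_kummer_inf_P W K p w x
  -- a subgroup containing the kernel is the preimage of its image (for the linear `loc`)
  have hmap : ∀ (v : HeightOneSpectrum (𝓞 K)) (H : AddSubgroup (Vp W K p)),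
      (W.baseChange K).torsionLocalKer (v.adicCompletion K) ((p ^ 1 : ℕ) : ℤ) ≤ H → ∀ x : Vp W K p,
      x ∈ H ↔ loc (Sum.inr v) x ∈ Submodule.map (loc (Sum.inr v)) (AddSubgroup.toZModSubmodule p H) := by
    intro v H hH x
    refine ⟨fun hx ↦ Submodule.mem_map_of_mem (by rwa [AddSubgroup.mem_toZModSubmodule]), fun hx ↦ ?_⟩
    obtain ⟨y, hy, hyx⟩ := Submodule.mem_map.mp hx
    rw [AddSubgroup.mem_toZModSubmodule] at hy
    have hk : x - y ∈ (W.baseChange K).torsionLocalKer (v.adicCompletion K) ((p ^ 1 : ℕ) : ℤ) := by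
      rw [hZero, map_sub, hyx, sub_self]
    have := H.add_mem (hH hk) hy
    rwa [sub_add_cancel] at this
  have hTor : ∀ (v : HeightOneSpectrum (𝓞 K)) (x : Vp W K p),
      x ∈ toricLocalKer (W.baseChange K) (v.adicCompletion K) ((p ^ 1 : ℕ) : ℤ) ↔ loc (Sum.inr v) x ∈ Tor v := by
    intro v x
    refine hmap v _ (fun y hy ↦ ?_) x
    -- the zero local class is toric (represented by the zero cocycle)
    change (W.baseChange K).torsionLocMap (v.adicCompletion K) _ y = 0 at hy
    change y ∈ AddSubgroup.comap _ _
    rw [AddSubgroup.mem_comap, hy]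
    exact AddSubgroup.zero_mem _
  have hTr : ∀ (ℓ : {ℓ // Zhang2014.IsKolyvaginPrime (W.conductorNorm ℤ) W K p ℓ}) (x : Vp W K p),
      x ∈ transverseLocalKerP W K p ι ℓ (plK ℓ) ↔ loc (Sum.inr (plK ℓ)) x ∈ Tr ℓ :=
    fun ℓ x ↦ hmap (plK ℓ) _ (torsionLocalKer_le_transverseLocalKerP W K p ι ℓ (plK ℓ)) x
  -- the level structure at `n₀`
  have hLinf : ∀ (w : InfinitePlace K), L (Sum.inl w) = Kum (Sum.inl w) := fun w ↦ rfl
  have hLkum : ∀ (v : HeightOneSpectrum (𝓞 K)),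
      (∀ q ∈ n₀, ((q : ℕ) : 𝓞 K) ∉ v.asIdeal) → L (Sum.inr v) = Kum (Sum.inr v) := by
    intro v hv
    have hneg : ¬ ∃ q ∈ n₀, ((q : ℕ) : 𝓞 K) ∈ v.asIdeal := fun ⟨q, hq, hqv⟩ ↦ hv q hq hqv
    show (if ∃ q ∈ n₀, ((q : ℕ) : 𝓞 K) ∈ v.asIdeal then Tor v else Kum (Sum.inr v)) = Kum (Sum.inr v)
    rw [if_neg hneg]
  have hLtor : ∀ (v : HeightOneSpectrum (𝓞 K)), ∀ q ∈ n₀, ((q : ℕ) : 𝓞 K) ∈ v.asIdeal → L (Sum.inr v) = Tor v := by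
    intro v q hq hqv
    show (if ∃ q ∈ n₀, ((q : ℕ) : 𝓞 K) ∈ v.asIdeal then Tor v else Kum (Sum.inr v)) = Tor v
    rw [if_pos ⟨q, hq, hqv⟩]
  -- isotropy of the level structure (Kummer everywhere; TORIC above the admissible level primes) and of `Tr`
  have hisoL : ∀ (v : Place K), ∀ x ∈ L v, ∀ y ∈ L v, Lp.b v x y = 0 := by
    intro v x hx y hy
    rcases v with w | v
    · change x ∈ AddSubgroup.toZModSubmodule p _ at hx
      change y ∈ AddSubgroup.toZModSubmodule p _ at hy
      rw [AddSubgroup.mem_toZModSubmodule] at hx hy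
      exact Lp.isoKummer (Sum.inl w) x hx y hy
    · by_cases h : ∃ q ∈ n₀, ((q : ℕ) : 𝓞 K) ∈ v.asIdeal
      · obtain ⟨q, hq, hqv⟩ := h
        rw [hLtor v q hq hqv] at hx hy
        obtain ⟨x', hx', rfl⟩ := Submodule.mem_map.mp hx
        obtain ⟨y', hy', rfl⟩ := Submodule.mem_map.mp hy
        rw [AddSubgroup.mem_toZModSubmodule] at hx' hy'
        exact Lp.isoToric q v hqv x' y' hx' hy'
      · push Not at h
        rw [hLkum v h] at hx hy
        change x ∈ AddSubgroup.toZModSubmodule p _ at hx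
        change y ∈ AddSubgroup.toZModSubmodule p _ at hy
        rw [AddSubgroup.mem_toZModSubmodule] at hx hy
        exact Lp.isoKummer (Sum.inr v) x hx y hy
  have hisoT : ∀ (ℓ : {ℓ // Zhang2014.IsKolyvaginPrime (W.conductorNorm ℤ) W K p ℓ}), ∀ x ∈ Tr ℓ, ∀ y ∈ Tr ℓ,
      Lp.b (Sum.inr (plK ℓ)) x y = 0 := by
    intro ℓ x hx y hy
    obtain ⟨x', hx', rfl⟩ := Submodule.mem_map.mp hx
    obtain ⟨y', hy', rfl⟩ := Submodule.mem_map.mp hy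
    rw [AddSubgroup.mem_toZModSubmodule] at hx' hy'
    exact Lp.isoTransverse ℓ ℓ.2 (plK ℓ) (hplK ℓ) x' y' hx' hy'
  -- (Perf) and (Line) in engine currency
  have hperf' : ∀ (ℓ : {ℓ // Zhang2014.IsKolyvaginPrime (W.conductorNorm ℤ) W K p ℓ}) (s : Bool),
      ∀ x ∈ E s, ∀ y ∈ E s, loc (Sum.inr (plK ℓ)) x ∈ Kum (Sum.inr (plK ℓ)) → loc (Sum.inr (plK ℓ)) x ≠ 0 →
      loc (Sum.inr (plK ℓ)) y ∈ Tr ℓ → loc (Sum.inr (plK ℓ)) y ≠ 0 →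
      Lp.b (Sum.inr (plK ℓ)) (loc (Sum.inr (plK ℓ)) x) (loc (Sum.inr (plK ℓ)) y) ≠ 0 := by
    intro ℓ s x hx y hy hxK hx0 hyT hy0
    exact Lp.perf ℓ ℓ.2 (plK ℓ) (hplK ℓ) s x y ((hE s x).mp hx) ((hE s y).mp hy) ((hKumFin _ x).mpr hxK)
      (fun h ↦ hx0 ((hZero _ x).mp h)) ((hTr ℓ y).mpr hyT) (fun h ↦ hy0 ((hZero _ y).mp h))
  have hline' : ∀ (ℓ : {ℓ // Zhang2014.IsKolyvaginPrime (W.conductorNorm ℤ) W K p ℓ}) (s : Bool),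
      ∃ e : galoisCohomology (ρ.toLocal (Sum.inr (plK ℓ))) 1, ∀ x ∈ E s,
      loc (Sum.inr (plK ℓ)) x ∈ Kum (Sum.inr (plK ℓ)) → ∃ a : ZMod p, loc (Sum.inr (plK ℓ)) x = a • e := by
    intro ℓ s
    obtain ⟨e, he⟩ := Lp.line ℓ ℓ.2 (plK ℓ) (hplK ℓ) s
    exact ⟨e, fun x hx hxK ↦ he x ((hE s x).mp hx) ((hKumFin _ x).mpr hxK)⟩
  -- (REC)
  have hrec : ∀ (x y : Vp W K p) (T : Finset (Place K)), (∀ v, v ∉ T → Lp.b v (loc v x) (loc v y) = 0) →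
      ∑ v ∈ T, Lp.b v (loc v x) (loc v y) = 0 := fun x y T hT ↦ Lp.reciprocity x y T hT
  -- (Cheb) ×2 from McCallum's Cor. 3.2
  have hCheb1 := chebOne_of_mcCallum_P W K p c hK hp2 hsurj hc loc plK hplK hZero
  have hCheb2 := chebTwo_of_mcCallum_P W K p c hK hp2 hsurj hc loc E plK hplK hE hZero
  -- (Supply) in engine currency, at the non-empty level `n₀`
  have hSupply' : ∀ (ℓ : {ℓ // Zhang2014.IsKolyvaginPrime (W.conductorNorm ℤ) W K p ℓ}) (T : Finset _), ℓ ∉ T →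
      ∀ s : Bool, ∃ x ∈ E s, x ≠ 0 ∧
        (∀ v : Place K, v ≠ Sum.inr (plK ℓ) → (∀ ℓ' ∈ T, Sum.inr (plK ℓ') ≠ v) → loc v x ∈ L v) ∧
        ∀ ℓ' ∈ T, loc (Sum.inr (plK ℓ')) x ∈ Tr ℓ' := by
    intro ℓ T hℓT s
    obtain ⟨x, hxs, hx0, hinf', hfin, htr'⟩ := Lp.supply n₀ hn₀ ℓ T hℓT s
    refine ⟨x, (hE s x).mpr hxs, hx0, fun v hv hvT ↦ ?_,
      fun ℓ' hℓ' ↦ (hTr ℓ' x).mp (htr' ℓ' hℓ' (plK ℓ') (hplK ℓ'))⟩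
    rcases v with w | v
    · show loc (Sum.inl w) x ∈ Kum (Sum.inl w)
      exact (hKumInf w x).mp (hinf' w)
    · have hv' : ((ℓ : ℕ) : 𝓞 K) ∉ v.asIdeal := fun h ↦ hv (by rw [hKuniq ℓ v h])
      have hvT' : ∀ ℓ' ∈ T, ((ℓ' : ℕ) : 𝓞 K) ∉ v.asIdeal := fun ℓ' hℓ'T h ↦ hvT ℓ' hℓ'T (by rw [hKuniq ℓ' v h])
      obtain ⟨hk, ho⟩ := hfin v hv' hvT'
      by_cases h : ∃ q ∈ n₀, ((q : ℕ) : 𝓞 K) ∈ v.asIdeal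
      · obtain ⟨q, hq, hqv⟩ := h
        rw [hLtor v q hq hqv]; exact (hTor v x).mp (ho q hq hqv)
      · push Not at h
        rw [hLkum v h]; exact (hKumFin v x).mp (hk h)
  exact kappa_empty_ne_zero_of_dictionaries W K p ι c n₀ ε κ loc Lp.b E Kum Tor plK Tr L hplK hE hKumInf hKumFin
    hTor hTr hZero hLinf hLkum hLtor hisoL hisoT hperf' hline' hrec hCheb1 hCheb2 hSupply' hsign hoff hinf htor htr
    hrel hrk hne

end Package

/-! ## §4 The registered stub, verbatim -/

/-- **VANISHING ORDER ZERO AT RANK ONE — the registered signature of `stub_kolyvaginRankOneVanishing` (line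
`additive_fibre_ignition` of crux KS′), verbatim.** Granted the route's displayed PUB and DUAL conjunctions, at a ♯
additive frame, over the abstract geometric bipartite datum `(ε₀, κ₀, lam)` (realisation at level `∅`, sign at every
even level, Selmer off ∕ at infinity, toric on the level, transverse on the conductor, relation (8.1), the two-sided
laws (A)/(B)): at a non-empty even level `n₀` of total canonical rank `≤ 1`, if some `κ₀ m n₀ ≠ 0` then `κ₀ ∅ n₀ ≠ 0`.
Proof: the unique `ZMod p`-structures on the local `H¹`'s, the local–global package from DUAL.2
(`kolyvaginLocalPackageP_of_poitouTate`), and §3 with the datum's rows at `n₀`. Uses of the frame only `5 ≤ p`, `ρ̄`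
onto, `K` imaginary quadratic, `d_K < −4`, `c ≠ 1`; PUB, realisation, `lam` and the laws (A)/(B) are idle. BSD is NOT
proved by this. [cite: WZhang2014, Lemma 8.4 (1), pp. 236–238; Lemma 8.1; Lemma 8.2] [cite: McCallumLMS1991, Cor. 3.2]
[cite: MilneADT2006, Ch. I, Thm. 4.10] -/
theorem kolyvaginRankOneVanishing :
    PublishedInputsAdditiveKoly → PublishedDualityInputsAdditiveKoly →
    ∀ (W : WeierstrassCurve ℚ) [W.IsElliptic] [W.IsGloballyMinimal] [NeZero (W.conductorNorm ℤ)]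
      (p : ℕ) [Fact p.Prime] (K : Type) [Field K] [NumberField K]
      (Dt : ModularParametrizationData W (W.conductorNorm ℤ)) (β : ℤ) (ι : K →+* ℂ),
      5 ≤ p → Addv W p → W.HasSurjectiveModNGaloisRep p →
      (∀ (ℓ : ℕ) [Fact ℓ.Prime], W.HasMultiplicativeReductionAtPrime ℓ →
        ¬ p ∣ padicValInt ℓ W.minimalDiscriminantInt) →
      (∃ (ℓ₁ ℓ₂ : ℕ) (_ : Fact ℓ₁.Prime) (_ : Fact ℓ₂.Prime), ℓ₁ ≠ ℓ₂ ∧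
        W.HasMultiplicativeReductionAtPrime ℓ₁ ∧ W.HasMultiplicativeReductionAtPrime ℓ₂) →
      ¬ p ∣ W.tamagawaProduct → W.analyticRank = 1 →
      IsImaginaryQuadratic K → Odd (NumberField.discr K) → NumberField.discr K < -4 →
      SatisfiesHeegnerHypothesis (W.conductorNorm ℤ) K →
      (W.quadraticTwist (NumberField.discr K : ℚ)).entireLFunction 1 ≠ 0 →
      (4 * (W.conductorNorm ℤ : ℤ)) ∣ β ^ 2 - NumberField.discr K → ¬ (p : ℤ) ∣ Dt.c →
      ∀ (c : K ≃ₐ[ℚ] K), c ≠ 1 → ∀ [Module (ZMod p) (Vp W K p)],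
      ∀ (ε₀ : Finset (AdmQ W K p) → Bool)
        (κ₀ : Finset {ℓ // Zhang2014.IsKolyvaginPrime (W.conductorNorm ℤ) W K p ℓ} → Finset (AdmQ W K p) → Vp W K p)
        (lam : Finset {ℓ // Zhang2014.IsKolyvaginPrime (W.conductorNorm ℤ) W K p ℓ} → Finset (AdmQ W K p) → ZMod p),
        -- realisation at level `∅`: the classes ARE the frame's Kolyvagin classes mod `p`
        (∀ m : Finset {ℓ // Zhang2014.IsKolyvaginPrime (W.conductorNorm ℤ) W K p ℓ},
          ∃ d : KolyvaginHeegnerData Dt β ι (∏ ℓ ∈ m, (ℓ : ℕ)), κ₀ m ∅ = d.kolyvaginClass (Fact.out : p.Prime) 1) →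
        -- sign at EVERY even level, `∅` included (Gross Prop. 5.4 (2) at level `∅`; the socket's row is the `n.Nonempty` restriction)
        (∀ n : Finset (AdmQ W K p), Even n.card →
          ∀ m : Finset {ℓ // Zhang2014.IsKolyvaginPrime (W.conductorNorm ℤ) W K p ℓ},
          conjAct W c ((p ^ 1 : ℕ) : ℤ) (κ₀ m n) = sgnP (ε₀ n ^^ Nat.bodd m.card) • κ₀ m n) →
        -- selmer_off
        (∀ n : Finset (AdmQ W K p), n.Nonempty → Even n.card →
          ∀ (m : Finset {ℓ // Zhang2014.IsKolyvaginPrime (W.conductorNorm ℤ) W K p ℓ}) (v : HeightOneSpectrum (𝓞 K)),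
          (∀ ℓ ∈ m, ((ℓ : ℕ) : 𝓞 K) ∉ v.asIdeal) → (∀ q ∈ n, ((q : ℕ) : 𝓞 K) ∉ v.asIdeal) →
          κ₀ m n ∈ selmerLocalKer (W.baseChange K) (v.adicCompletion K) ((p ^ 1 : ℕ) : ℤ)) →
        -- selmer_inf
        (∀ n : Finset (AdmQ W K p), n.Nonempty → Even n.card →
          ∀ (m : Finset {ℓ // Zhang2014.IsKolyvaginPrime (W.conductorNorm ℤ) W K p ℓ}) (w : InfinitePlace K),
          κ₀ m n ∈ selmerLocalKer (W.baseChange K) w.Completion ((p ^ 1 : ℕ) : ℤ)) →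
        -- toric_on
        (∀ n : Finset (AdmQ W K p), n.Nonempty → Even n.card →
          ∀ m : Finset {ℓ // Zhang2014.IsKolyvaginPrime (W.conductorNorm ℤ) W K p ℓ}, ∀ q ∈ n,
          ∀ v : HeightOneSpectrum (𝓞 K), ((q : ℕ) : 𝓞 K) ∈ v.asIdeal →
          κ₀ m n ∈ toricLocalKer (W.baseChange K) (v.adicCompletion K) ((p ^ 1 : ℕ) : ℤ)) →
        -- transverse_on
        (∀ n : Finset (AdmQ W K p), n.Nonempty → Even n.card →
          ∀ m : Finset {ℓ // Zhang2014.IsKolyvaginPrime (W.conductorNorm ℤ) W K p ℓ}, ∀ ℓ ∈ m,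
          ∀ v : HeightOneSpectrum (𝓞 K), ((ℓ : ℕ) : 𝓞 K) ∈ v.asIdeal → κ₀ m n ∈ transverseLocalKerP W K p ι ℓ v) →
        -- relation (8.1)
        (∀ n : Finset (AdmQ W K p), n.Nonempty → Even n.card →
          ∀ (m : Finset {ℓ // Zhang2014.IsKolyvaginPrime (W.conductorNorm ℤ) W K p ℓ})
            (ℓ : {ℓ // Zhang2014.IsKolyvaginPrime (W.conductorNorm ℤ) W K p ℓ}), ℓ ∉ m →
          ∀ v : HeightOneSpectrum (𝓞 K), ((ℓ : ℕ) : 𝓞 K) ∈ v.asIdeal →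
          (κ₀ (insert ℓ m) n ∈ (W.baseChange K).torsionLocalKer (v.adicCompletion K) ((p ^ 1 : ℕ) : ℤ) ↔
            κ₀ m n ∈ (W.baseChange K).torsionLocalKer (v.adicCompletion K) ((p ^ 1 : ℕ) : ℤ))) →
        -- law (A), TWO-SIDED: the value one level up is a unit iff the class is detected at the NEW prime
        (∀ (n : Finset (AdmQ W K p)) (q : AdmQ W K p), Even n.card → q ∉ n →
          ∀ m : Finset {ℓ // Zhang2014.IsKolyvaginPrime (W.conductorNorm ℤ) W K p ℓ},
          lam m (insert q n) ≠ 0 ↔ ∃ v : HeightOneSpectrum (𝓞 K), ((q : ℕ) : 𝓞 K) ∈ v.asIdeal ∧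
            κ₀ m n ∉ (W.baseChange K).torsionLocalKer (v.adicCompletion K) ((p ^ 1 : ℕ) : ℤ)) →
        -- law (B), TWO-SIDED: the class is detected at a LEVEL prime iff the value one level down is a unit
        (∀ (n : Finset (AdmQ W K p)) (q : AdmQ W K p), Odd n.card → q ∉ n →
          ∀ m : Finset {ℓ // Zhang2014.IsKolyvaginPrime (W.conductorNorm ℤ) W K p ℓ},
          (∃ v : HeightOneSpectrum (𝓞 K), ((q : ℕ) : 𝓞 K) ∈ v.asIdeal ∧
            κ₀ m (insert q n) ∉ (W.baseChange K).torsionLocalKer (v.adicCompletion K) ((p ^ 1 : ℕ) : ℤ)) ↔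
            lam m n ≠ 0) →
        ∀ n₀ : Finset (AdmQ W K p), n₀.Nonempty → Even n₀.card →
          finrank (ZMod p) (SelQP W K p c n₀ true) + finrank (ZMod p) (SelQP W K p c n₀ false) ≤ 1 →
          (∃ m : Finset {ℓ // Zhang2014.IsKolyvaginPrime (W.conductorNorm ℤ) W K p ℓ}, κ₀ m n₀ ≠ 0) → κ₀ ∅ n₀ ≠ 0 := by
  intro _ hDual W _ _ _ p _ K _ _ Dt β ι h5 _ hsurj _ _ _ _ hK _ hd _ _ _ _ c hc _ ε₀ κ₀ _ _ hsgn hoff hinf htor htr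
    hrel _ _ n₀ hn₀ heven hrk hne
  have hp : p.Prime := Fact.out
  have hp2 : p ≠ 2 := by omega
  -- the unique `ZMod p`-module structures on the `H¹(K_v, E[p])`
  letI : ∀ v : Place K, Module (ZMod p)
      (galoisCohomology (((W.baseChange K).torsionGaloisModule ((p ^ 1 : ℕ) : ℤ)).toLocal v) 1) := fun v ↦
    AddCommGroup.zmodModule (fun x ↦ by
      have h := galoisCohomology.nsmul_eq_zero_of_forall
        (((W.baseChange K).torsionGaloisModule ((p ^ 1 : ℕ) : ℤ)).toLocal v) (n := p ^ 1)
        (fun m => AddSubgroup.torsionBy.nsmul m) x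
      simpa using h)
  -- cup products need compact absolute Galois groups; `E[p](K̄)` is finite
  haveI : NeZero (p ^ 1 : ℕ) := ⟨pow_ne_zero 1 hp.ne_zero⟩
  haveI : ∀ v : Place K, CompactSpace (Field.absoluteGaloisGroup (Place.Completion v)) := fun v ↦
    Literature.NumberTheory.GaloisRepresentations.absoluteGaloisGroup_compactSpace _
  haveI : Finite (geomTorsion (W.baseChange K) ((p ^ 1 : ℕ) : ℤ)) :=
    finite_geomTorsion_of_neZero (W.baseChange K) (p ^ 1)
  obtain ⟨Lp⟩ := kolyvaginLocalPackageP_of_poitouTate W K p ι c hK hp2 hd hsurj hc (hDual.2 K)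
  exact kappa_empty_ne_zero_of_localPackage W K p ι c hp2 hK hsurj hc Lp n₀ hn₀ (ε₀ n₀) (fun m ↦ κ₀ m n₀)
    (hsgn n₀ heven) (hoff n₀ hn₀ heven) (hinf n₀ hn₀ heven) (htor n₀ hn₀ heven) (htr n₀ hn₀ heven)
    (hrel n₀ hn₀ heven) hrk hne

end Summit.BirchSwinnertonDyer.BirchSwinnertonDyer.Theorems.AdditiveKoly

end
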